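import Mathlib.Analysis.Calculus.ContDiff.Defs
import Mathlib.Analysis.Calculus.FDeriv.Basic
import Mathlib.Analysis.Complex.Basic
import Mathlib.LinearAlgebra.FiniteDimensional.Defs
import HarnessLib

/-!
# Zeros of solutions of the `∂̄`-inequality `|∂̄v| ≤ K|v|` (Carleman–Bers–Vekua similarity principle)

A NAMED FACT of elementary elliptic analysis in one complex variable, the analytic atom under the
unique-continuation and intersection statements of the local theory of `J`-holomorphic curves:

* `Literature.Geometry.Symplectic.dbarInequality_zeroDichotomy` — let `v` be a `C¹` map from a
  disc `ball c r ⊆ ℂ` into a finite-dimensional complex normed space with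
  `‖∂ₛv + i ∂ₜv‖ ≤ K ‖v‖` pointwise (`∂ₛv = Dv(1)`, `∂ₜv = Dv(i)`, so `∂ₛv + i∂ₜv = 2 ∂̄v`) and
  `v c = 0`. Then EITHER `v` vanishes on a neighbourhood of `c`, OR `c` is an isolated zero
  (`v ≠ 0` on a punctured neighbourhood).

Source: the similarity principle — Wendl, *Lectures on holomorphic curves* (arXiv:1011.1690),
Thm 2.50: for `A ∈ L^∞(B, End_ℝ(ℂⁿ))` and `u ∈ W^{1,p}(B, ℂⁿ)`, `p > 2`, with `∂̄u + Au = 0`, on a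
small disc `u = Φ f` with `Φ` continuous, invertible, `Φ(0) = 𝟙`, and `f` holomorphic; hence zeros
of `u` are those of the holomorphic `f`: isolated or a whole neighbourhood. The inequality
`|∂̄v| ≤ K|v|` is the equation `∂̄v + Av = 0` with the bounded measurable
`A := −(∂̄v) ⊗ v^*/|v|²` off the zero set (and `∂̄v = 0` on it, by the inequality). Classical
form: T. Carleman (1939), L. Bers, I. N. Vekua (*Generalized analytic functions*, 1962);
McDuff–Salamon 2012 §2.3 ("Carleman similarity principle").

Consumers (summit `SmoothPoincare4`, crux `WitnessCharge`, line `Sketch`): the flat unique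
continuation `jHolomorphicFlat_uniqueContinuation_const` (reduce `Du(iζ) = Jc(u)Du(ζ)` to the
inequality by a local trivialisation of `z ↦ Jc(u z)`), and the intersection dichotomy
`jHolomorphic_intersectionDichotomy` (in coordinates straightening the regular branch, the normal
component of the other branch satisfies the inequality). Design: the real derivative `fderiv ℝ` of a
map into a complex space (`NormedSpace.complexToReal`); `C¹` on the open disc; any real `K`.
Deliberately NOT here: the factorisation `v = Φ f` itself, the order of vanishing / leading term
`a (z − c)^k`, the Cauchy transform.
-/

noncomputable section

open scoped ContDiff Topology
open Set Filter

namespace Literature.Geometry.Symplectic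

/-- **Zero dichotomy for the `∂̄`-inequality (similarity principle; Wendl, Lectures, Thm 2.50;
Carleman 1939 / Bers / Vekua).** Let `F` be a finite-dimensional complex normed space,
`v : ℂ → F` of class `C¹` on `ball c r` with `‖Dv(z)(1) + i • Dv(z)(i)‖ ≤ K ‖v z‖` for all
`z ∈ ball c r` (that is `|∂̄v| ≤ (K/2)|v|`) and `v c = 0`. Then either `v = 0` on a neighbourhood
of `c`, or `v z ≠ 0` for all `z ≠ c` in a neighbourhood of `c`. (By Thm 2.50, `v = Φ f` near `c`
with `Φ` continuous invertible and `f` holomorphic, `f c = 0`; the zero of the holomorphic `f` at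
`c` is isolated unless `f ≡ 0` near `c`.)
[cite: WendlLectures2010, Thm 2.50] -/
def dbarInequality_zeroDichotomy : Prop :=
  ∀ (F : Type) [NormedAddCommGroup F] [NormedSpace ℂ F] [FiniteDimensional ℂ F]
    (c : ℂ) (r K : ℝ), 0 < r →
    ∀ (v : ℂ → F), ContDiffOn ℝ 1 v (Metric.ball c r) →
      (∀ z ∈ Metric.ball c r,
        ‖fderiv ℝ v z 1 + Complex.I • fderiv ℝ v z Complex.I‖ ≤ K * ‖v z‖) →
      v c = 0 →
      (∀ᶠ z in 𝓝 c, v z = 0) ∨ (∀ᶠ z in 𝓝[≠] c, v z ≠ 0)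

end Literature.Geometry.Symplectic
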